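import Mathlib
import Literature.NumberTheory.NumberFields.PureCubicClassNumberModThreeProofs
import HarnessLib

/-!
# Field set-up for the ambiguous-class argument: `L = K(ζ₃) ⊇ F = ℚ(ζ₃)`

For primes `p ≡ 2`, `q ≡ 5 (mod 9)` and a cubic number field `K ∋ α`, `α³ = pq`: the sextic
field `L = K(ζ₃)` (a `{3}`-cyclotomic extension of `K`), its subfield `F = ℚ(ζ₃)`, and the
arithmetic consumed by Chevalley's ambiguous-class argument — `[L:K] = 2`, `[L:ℚ] = 6`, `L/F`
cyclic cubic, `𝓞_F` a PID with units `±ζ₃^i`, `F` totally complex, `θ = α ∈ L`, and the primes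
`P₁ ∋ p`, `P₂ ∋ q` of `L`, totally ramified over the inert primes `p𝓞_F`, `q𝓞_F`
(`p𝓞_L = P₁³`, `q𝓞_L = P₂³`, `e(P₁ | p𝓞_F) = 3`, `#𝓞_F/(p) = p²`).
-/

noncomputable section

open Polynomial NumberField

open scoped Pointwise NumberField IntermediateField

namespace Summit.QuantumAdvantage.QuantumAdvantage.Theorems.LinnikCubicClassGroups

/-- Over a cubic number field the third cyclotomic polynomial `X² + X + 1` is irreducible:
a primitive cube root of unity would generate a quadratic subfield, and `2 ∤ 3`. [folklore] -/
theorem irreducible_cyclotomic_three_of_finrank_eq_three {K : Type*} [Field K] [NumberField K]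
    (hK : Module.finrank ℚ K = 3) : Irreducible (cyclotomic 3 K) := by
  have hdeg : (cyclotomic 3 K).natDegree = 2 := by
    rw [natDegree_cyclotomic, Nat.totient_prime Nat.prime_three]
  rw [irreducible_iff_roots_eq_zero_of_degree_le_three (by omega) (by omega),
    Multiset.eq_zero_iff_forall_notMem]
  intro ω hω
  rw [mem_roots (cyclotomic_ne_zero 3 K), isRoot_cyclotomic_iff] at hω
  have hint : IsIntegral ℚ ω := .of_finite ℚ ω
  have h2 : Module.finrank ℚ ℚ⟮ω⟯ = 2 := by
    rw [IntermediateField.adjoin.finrank hint, ← cyclotomic_eq_minpoly_rat hω (by norm_num),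
      natDegree_cyclotomic, Nat.totient_prime Nat.prime_three]
  have htower := Module.finrank_mul_finrank ℚ ℚ⟮ω⟯ K
  rw [h2, hK] at htower
  omega

/-- **`K(ζ₃)` is Galois over `ℚ` for `K = ℚ(∛(pq))`**: it is the splitting field over `ℚ` of
`(X³ − pq)(X³ − 1)` (the roots `ζ₃^i ∛(pq)`, `ζ₃^i` all lie in `K(ζ₃)`, and `∛(pq)`, `ζ₃`
generate it). [folklore] -/
theorem isGalois_rat_of_isCyclotomicExtension_three {p q : ℕ} (hp : p.Prime) (hq : q.Prime)
    (hpq : p ≠ q) {K : Type*} [Field K] [NumberField K] (hK : Module.finrank ℚ K = 3) {α : K}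
    (hα : α ^ 3 = ((p * q : ℕ) : K)) (L : Type*) [Field L] [NumberField L] [Algebra K L]
    [IsCyclotomicExtension {3} K L] : IsGalois ℚ L := by
  obtain ⟨ζ, hζ⟩ : ∃ ζ : L, IsPrimitiveRoot ζ 3 := ⟨_, IsCyclotomicExtension.zeta_spec 3 K L⟩
  obtain ⟨θ, hθdef⟩ : ∃ θ : L, θ = algebraMap K L α := ⟨_, rfl⟩
  have hθ : θ ^ 3 = ((p * q : ℕ) : L) := by rw [hθdef, ← map_pow, hα, map_natCast]
  obtain ⟨f, hfdef⟩ : ∃ f : ℚ[X], f = (X ^ 3 - C ((p * q : ℕ) : ℚ)) * (X ^ 3 - C 1) := ⟨_, rfl⟩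
  have hfmonic : f.Monic :=
    hfdef ▸ (monic_X_pow_sub_C _ three_ne_zero).mul (monic_X_pow_sub_C _ three_ne_zero)
  have hsplit : (f.map (algebraMap ℚ L)).Splits := by
    rw [hfdef, Polynomial.map_mul]
    refine Splits.mul ?_ ?_
    · have h1 : (X ^ 3 - C ((p * q : ℕ) : ℚ)).map (algebraMap ℚ L) =
          X ^ 3 - C ((p * q : ℕ) : L) := by
        simp [Polynomial.map_sub, Polynomial.map_pow]
      rw [h1]
      exact X_pow_sub_C_splits_of_isPrimitiveRoot hζ hθ
    · have h1 : (X ^ 3 - C (1 : ℚ)).map (algebraMap ℚ L) = X ^ 3 - C (1 : L) := by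
        simp [Polynomial.map_sub, Polynomial.map_pow]
      rw [h1]
      exact X_pow_sub_C_splits_of_isPrimitiveRoot hζ (one_pow 3)
  have hθroot : θ ∈ f.rootSet L := hfmonic.mem_rootSet.mpr (by simp [hfdef, hθ])
  have hζroot : ζ ∈ f.rootSet L := hfmonic.mem_rootSet.mpr (by simp [hfdef, hζ.pow_eq_one])
  have htop : IntermediateField.adjoin ℚ (f.rootSet L) = ⊤ := by
    have hθE : θ ∈ IntermediateField.adjoin ℚ (f.rootSet L) :=
      IntermediateField.subset_adjoin ℚ _ hθroot
    have hζE : ζ ∈ IntermediateField.adjoin ℚ (f.rootSet L) :=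
      IntermediateField.subset_adjoin ℚ _ hζroot
    -- the image of `K = ℚ(α)` lies in `ℚ(roots)`
    have hKE : ∀ k : K, algebraMap K L k ∈ IntermediateField.adjoin ℚ (f.rootSet L) := by
      intro k
      have hk : k ∈ IntermediateField.adjoin ℚ {α} := by
        rw [Literature.NumberTheory.NumberFields.Honda1971.adjoin_eq_top hp hq hpq hK hα]
        exact IntermediateField.mem_top
      have hk' : algebraMap K L k ∈
          (IntermediateField.adjoin ℚ {α}).map (IsScalarTower.toAlgHom ℚ K L) :=
        (IntermediateField.mem_map _).mpr ⟨k, hk, rfl⟩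
      rw [IntermediateField.adjoin_map, Set.image_singleton, IsScalarTower.coe_toAlgHom',
        ← hθdef] at hk'
      exact IntermediateField.adjoin_le_iff.mpr (Set.singleton_subset_iff.mpr hθE) hk'
    -- and `L = K(ζ)`
    rw [eq_top_iff]
    rintro x -
    have hx : x ∈ Algebra.adjoin K ({ζ} : Set L) := by
      rw [IsCyclotomicExtension.adjoin_primitive_root_eq_top hζ]
      exact Algebra.mem_top
    induction hx using Algebra.adjoin_induction with
    | mem x hx =>
      rw [Set.mem_singleton_iff] at hx
      rw [hx]
      exact hζE
    | algebraMap r => exact hKE r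
    | add x y _ _ hx hy => exact add_mem hx hy
    | mul x y _ _ hx hy => exact mul_mem hx hy
  haveI : f.IsSplittingField ℚ L := isSplittingField_iff_intermediateField.mpr ⟨hsplit, htop⟩
  haveI : Normal ℚ L := Normal.of_isSplittingField f
  exact { to_isSeparable := inferInstance, to_normal := inferInstance }

/-- **The units of `ℚ(ζ₃)` are `±ζ₃^i`** (Mathlib's `IsCyclotomicExtension.Rat.Three.Units.mem`,
repackaged). [folklore] -/
theorem exists_units_eq_pow_or_neg_pow {F : Type*} [Field F] [NumberField F]
    [IsCyclotomicExtension {3} ℚ F] {ζ : F} (hζ : IsPrimitiveRoot ζ 3) :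
    ∃ η : (𝓞 F)ˣ, ((η : 𝓞 F) : F) = ζ ∧ ∀ w : (𝓞 F)ˣ, ∃ i : ℕ, w = η ^ i ∨ w = -η ^ i := by
  refine ⟨(IsPrimitiveRoot.isUnit hζ.toInteger_isPrimitiveRoot (by decide)).unit, rfl,
    fun w => ?_⟩
  have hw := IsCyclotomicExtension.Rat.Three.Units.mem hζ w
  simp only [List.mem_cons, List.not_mem_nil, or_false] at hw
  rcases hw with h | h | h | h | h | h <;> subst h
  · exact ⟨0, Or.inl (pow_zero _).symm⟩
  · exact ⟨0, Or.inr (by rw [pow_zero])⟩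
  · exact ⟨1, Or.inl (pow_one _).symm⟩
  · exact ⟨1, Or.inr (by rw [pow_one])⟩
  · exact ⟨2, Or.inl rfl⟩
  · exact ⟨2, Or.inr rfl⟩

/-- **Total ramification of `p` in `L = K(ζ₃)`.**  Let `K ∋ α` be cubic with `α³ = pq`
(`p ≠ q` primes, `p ≡ 2 (mod 3)`), `L ⊇ K` a sextic number field and `F ⊆ L` a copy of
`ℚ(ζ₃)`.  Then there is a maximal ideal `P ∋ p` of `𝓞 L` with `p𝓞_L = P³`,
`e(P | P ∩ 𝓞_F) = 3`, `3 ∉ P ∩ 𝓞_F` and `#(𝓞_F / P ∩ 𝓞_F) = p²`.  (Fundamental identity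
`∑ e f = 6` over the primes above `p`: `3 ∣ e` through `K` — `p` is totally ramified in `K` —
and `2 ∣ f` through `F` — `p ≡ 2 (mod 3)` is inert in `ℚ(ζ₃)` — so there is a single prime,
with `e = 3`, `f = 2`.) [folklore] -/
theorem exists_prime_pow_three_eq_span {K L : Type*} [Field K] [NumberField K] [Field L]
    [NumberField L] [Algebra K L] (F : IntermediateField ℚ L) [IsCyclotomicExtension {3} ℚ F]
    (hL6 : Module.finrank ℚ L = 6) {p q : ℕ} (hp : p.Prime) (hq : q.Prime) (hpq : p ≠ q)
    (hp3 : p % 3 = 2) (hK : Module.finrank ℚ K = 3) {α : K} (hα : α ^ 3 = ((p * q : ℕ) : K)) :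
    ∃ P : Ideal (𝓞 L), P.IsMaximal ∧ (p : 𝓞 L) ∈ P ∧ Ideal.span {(p : 𝓞 L)} = P ^ 3 ∧
      P.ramificationIdx (𝓞 F) = 3 ∧ (3 : 𝓞 F) ∉ P.under (𝓞 F) ∧
      Nat.card ((𝓞 F) ⧸ P.under (𝓞 F)) = p ^ 2 := by
  haveI : Fact p.Prime := ⟨hp⟩
  -- the prime `pℤ`
  obtain ⟨𝔭, h𝔭def⟩ : ∃ 𝔭 : Ideal ℤ, 𝔭 = Ideal.span {(p : ℤ)} := ⟨_, rfl⟩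
  haveI h𝔭max : 𝔭.IsMaximal := h𝔭def ▸
    Ideal.IsPrime.isMaximal
      ((Ideal.span_singleton_prime (by exact_mod_cast hp.ne_zero)).mpr
        (Nat.prime_iff_prime_int.mp hp)) (by simpa using hp.ne_zero)
  have h𝔭0 : 𝔭 ≠ ⊥ := by
    rw [h𝔭def, Ne, Ideal.span_singleton_eq_bot]
    exact_mod_cast hp.ne_zero
  -- `p ∈ Q` for every prime `Q` above `pℤ`
  have hmem : ∀ (Q : Ideal (𝓞 L)) [Q.LiesOver 𝔭], (p : 𝓞 L) ∈ Q := by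
    intro Q _
    have h1 : ((p : ℕ) : ℤ) ∈ Q.under ℤ := by
      rw [← Ideal.over_def Q 𝔭, h𝔭def]
      exact Ideal.mem_span_singleton_self _
    rw [Ideal.under_def, Ideal.mem_comap, map_natCast] at h1
    exact h1
  -- `e(Q | p) = 3 · e(Q | 𝓞 K)`: `p` is totally ramified in `K`
  have he : ∀ (Q : Ideal (𝓞 L)) [Q.IsMaximal] [Q.LiesOver 𝔭],
      Q.ramificationIdx ℤ = 3 * Q.ramificationIdx (𝓞 K) := by
    intro Q _ _
    haveI : (Q.under (𝓞 K)).IsMaximal := Ideal.IsMaximal.under _ Q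
    have hne : Q.under (𝓞 K) ≠ ⊥ := Ideal.IsMaximal.ne_bot_of_isIntegral_int _
    let v : IsDedekindDomain.HeightOneSpectrum (𝓞 K) :=
      ⟨Q.under (𝓞 K), Ideal.IsMaximal.isPrime inferInstance, hne⟩
    have hpv : (p : 𝓞 K) ∈ v.asIdeal := by
      change (p : 𝓞 K) ∈ Q.under (𝓞 K)
      rw [Ideal.under_def, Ideal.mem_comap, map_natCast]
      exact hmem Q
    have h3 : (Q.under (𝓞 K)).ramificationIdx ℤ = 3 :=
      Literature.NumberTheory.NumberFields.Honda1971.ramificationIdx_eq_three hp hq hpq hK hα v hpv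
    rw [Ideal.ramificationIdx_tower (R := ℤ) (Q.under (𝓞 K)) Q, h3]
  -- `f(Q ∩ 𝓞F | p) = 2`: `p ≡ 2 (mod 3)` is inert in `ℚ(ζ₃)`
  have hp3' : ¬ p ∣ 3 := fun h => by
    have := (Nat.prime_dvd_prime_iff_eq hp Nat.prime_three).mp h
    omega
  have hord : orderOf (p : ZMod 3) = 2 := by
    haveI : Fact (Nat.Prime 2) := ⟨Nat.prime_two⟩
    have hcast : (p : ZMod 3) = 2 := by
      rw [← ZMod.natCast_mod, hp3]
      rfl
    rw [hcast]
    exact orderOf_eq_prime (by decide) (by decide)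
  have hfF : ∀ (Q : Ideal (𝓞 L)) [Q.IsMaximal] [Q.LiesOver 𝔭],
      (Q.under (𝓞 F)).inertiaDeg ℤ = 2 := by
    intro Q _ _
    haveI : (Q.under (𝓞 F)).LiesOver (Ideal.span {(p : ℤ)}) := h𝔭def ▸ inferInstance
    rw [IsCyclotomicExtension.Rat.inertiaDeg_eq_of_not_dvd p F (Q.under (𝓞 F)) hp3', hord]
  have hf : ∀ (Q : Ideal (𝓞 L)) [Q.IsMaximal] [Q.LiesOver 𝔭],
      Q.inertiaDeg ℤ = 2 * Q.inertiaDeg (𝓞 F) := by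
    intro Q _ _
    rw [Ideal.inertiaDeg_tower (R := ℤ) (Q.under (𝓞 F)) Q, hfF Q]
  -- every term of the fundamental identity `∑ e f = 6` is `≥ 6`
  have hge : ∀ Q : 𝔭.primesOver (𝓞 L), 6 ≤ Q.1.ramificationIdx ℤ * Q.1.inertiaDeg ℤ := by
    rintro ⟨Q, hQp, hQl⟩
    haveI : Q.IsMaximal := Ideal.IsMaximal.of_liesOver_isMaximal Q 𝔭
    have h1 := he Q
    have h2 := hf Q
    have h3 : 0 < Q.ramificationIdx (𝓞 K) := Ideal.ramificationIdx_pos _ _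
    have h4 : 0 < Q.inertiaDeg (𝓞 F) := Ideal.inertiaDeg_pos _ _
    change 6 ≤ Q.ramificationIdx ℤ * Q.inertiaDeg ℤ
    rw [h1, h2]
    nlinarith
  -- a prime `P` above `pℤ`; it is the only one, and `e(P|p) f(P|p) = 6`
  obtain ⟨P, hPmax, hPover⟩ := Ideal.exists_maximal_ideal_liesOver_of_isIntegral (S := 𝓞 L) 𝔭
  have hsum := Ideal.sum_ramification_inertia_eq_finrank 𝔭 (𝓞 L)
  rw [RingOfIntegers.rank, hL6] at hsum
  let P' : 𝔭.primesOver (𝓞 L) := ⟨P, hPmax.isPrime, hPover⟩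
  have huniq : ∀ Q : 𝔭.primesOver (𝓞 L), Q = P' := by
    intro Q
    by_contra hne
    have h2 : ∑ x ∈ ({Q, P'} : Finset (𝔭.primesOver (𝓞 L))),
        x.1.ramificationIdx ℤ * x.1.inertiaDeg ℤ ≤ 6 := by
      rw [← hsum]
      exact Finset.sum_le_sum_of_subset (Finset.subset_univ _)
    rw [Finset.sum_pair hne] at h2
    have := hge Q
    have := hge P'
    omega
  have hPef : P.ramificationIdx ℤ * P.inertiaDeg ℤ = 6 := by
    rw [← hsum]
    haveI : Subsingleton (𝔭.primesOver (𝓞 L)) := ⟨fun a b => (huniq a).trans (huniq b).symm⟩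
    exact (Fintype.sum_subsingleton
      (fun x : 𝔭.primesOver (𝓞 L) => x.1.ramificationIdx ℤ * x.1.inertiaDeg ℤ) P').symm
  have heP : P.ramificationIdx ℤ = 3 := by
    have h1 := he P
    have h2 := hf P
    have h3 : 0 < P.ramificationIdx (𝓞 K) := Ideal.ramificationIdx_pos _ _
    have h4 : 0 < P.inertiaDeg (𝓞 F) := Ideal.inertiaDeg_pos _ _
    rw [h1, h2] at hPef
    have h5 : P.ramificationIdx (𝓞 K) ≤ 1 := by nlinarith
    rw [h1]
    omega
  refine ⟨P, hPmax, hmem P, ?_, ?_, ?_, ?_⟩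
  · -- `p𝓞_L = P³`: `P` is the only prime factor, with multiplicity `e(P|p) = 3`
    have hI : Ideal.span {(p : 𝓞 L)} = 𝔭.map (algebraMap ℤ (𝓞 L)) := by
      rw [h𝔭def, Ideal.map_span, Set.image_singleton, map_natCast]
    have hI0 : 𝔭.map (algebraMap ℤ (𝓞 L)) ≠ ⊥ := by
      rw [← hI, Ne, Ideal.span_singleton_eq_bot]
      exact_mod_cast hp.ne_zero
    have hcount := Ideal.IsDedekindDomain.ramificationIdx_eq_normalizedFactors_count 𝔭 P hI0
    have hall : ∀ Q ∈ UniqueFactorizationMonoid.normalizedFactors (𝔭.map (algebraMap ℤ (𝓞 L))),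
        Q = P := by
      intro Q hQ
      have hQ' : Q ∈ 𝔭.primesOver (𝓞 L) := by
        rw [← IsDedekindDomain.coe_primesOverFinset h𝔭0 (𝓞 L), Finset.mem_coe,
          Multiset.mem_toFinset, UniqueFactorizationMonoid.factors_eq_normalizedFactors]
        exact hQ
      exact congrArg Subtype.val (huniq ⟨Q, hQ'⟩)
    have hnf : UniqueFactorizationMonoid.normalizedFactors (𝔭.map (algebraMap ℤ (𝓞 L))) =
        Multiset.replicate 3 P := by
      have h := Multiset.eq_replicate_card.mpr hall
      rw [h, Multiset.count_replicate_self, heP] at hcount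
      rw [h, ← hcount]
    rw [hI, ← Ideal.prod_normalizedFactors_eq_self hI0, hnf, Multiset.prod_replicate]
  · -- `e(P | P ∩ 𝓞F) = e(P|p) / e(P ∩ 𝓞F | p) = 3 / 1`
    have ht := Ideal.ramificationIdx_tower (R := ℤ) (P.under (𝓞 F)) P
    haveI : (P.under (𝓞 F)).LiesOver (Ideal.span {(p : ℤ)}) := h𝔭def ▸ inferInstance
    rw [heP, IsCyclotomicExtension.Rat.ramificationIdx_eq_of_not_dvd p F (P.under (𝓞 F)) hp3',
      one_mul] at ht
    exact ht.symm
  · -- `3 ∉ P ∩ 𝓞F ∋ p`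
    intro h3
    haveI : (P.under (𝓞 F)).IsMaximal := Ideal.IsMaximal.under _ P
    have hpF : (p : 𝓞 F) ∈ P.under (𝓞 F) := by
      rw [Ideal.under_def, Ideal.mem_comap, map_natCast]
      exact hmem P
    have hcop : IsCoprime (p : 𝓞 F) (3 : 𝓞 F) := by
      have h' : IsCoprime (p : ℤ) (3 : ℤ) :=
        Nat.isCoprime_iff_coprime.mpr ((Nat.coprime_primes hp Nat.prime_three).mpr (by omega))
      simpa using h'.map (Int.castRingHom (𝓞 F))
    obtain ⟨a, b, hab⟩ := hcop
    exact (Ideal.IsMaximal.ne_top inferInstance) ((Ideal.eq_top_iff_one _).mpr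
      (hab ▸ (P.under (𝓞 F)).add_mem ((P.under (𝓞 F)).mul_mem_left a hpF)
        ((P.under (𝓞 F)).mul_mem_left b h3)))
  · -- `#(𝓞F / P ∩ 𝓞F) = N(P ∩ 𝓞F) = p^f = p²`
    haveI : (P.under (𝓞 F)).LiesOver (Ideal.span {(p : ℤ)}) := h𝔭def ▸ inferInstance
    rw [← Submodule.cardQuot_apply, ← Ideal.absNorm_apply, ← Ideal.pow_inertiaDeg p (P.under (𝓞 F)),
      hfF P]

/-- **The construction for a given `{3}`-cyclotomic extension `L` of `K`.**  All conjuncts of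
`stub_fieldSetup` hold for any `L = K(ζ₃)`. [folklore] -/
theorem fieldSetup_of_isCyclotomicExtension {p q : ℕ} (hp : p.Prime) (hq : q.Prime)
    (hp9 : p % 9 = 2) (hq9 : q % 9 = 5) (K : Type*) [Field K] [NumberField K]
    (hK : Module.finrank ℚ K = 3) {α : K} (hα : α ^ 3 = ((p * q : ℕ) : K))
    (L : Type*) [Field L] [NumberField L] [Algebra K L] [IsCyclotomicExtension {3} K L] :
    Module.finrank K L = 2 ∧ Module.finrank ℚ L = 6 ∧
      ∃ F : IntermediateField ℚ L,
        IsGalois F L ∧ Module.finrank F L = 3 ∧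
        (∃ σ : L ≃ₐ[F] L, ∀ τ : L ≃ₐ[F] L, τ ∈ Subgroup.zpowers σ) ∧
        IsPrincipalIdealRing (𝓞 F) ∧
        (∀ v : NumberField.InfinitePlace F, v.IsComplex) ∧
        (∃ θ : L, θ ^ 3 = ((p * q : ℕ) : L)) ∧
        ∃ ζ : (𝓞 F)ˣ, ((ζ : 𝓞 F) : F) ^ 3 = 1 ∧ ((ζ : 𝓞 F) : F) ≠ 1 ∧
          (∀ w : (𝓞 F)ˣ, ∃ i : ℕ, w = ζ ^ i ∨ w = -ζ ^ i) ∧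
          ∃ P₁ P₂ : Ideal (𝓞 L), P₁.IsMaximal ∧ P₂.IsMaximal ∧ P₁ ≠ P₂ ∧
            Ideal.span {(p : 𝓞 L)} = P₁ ^ 3 ∧
            Ideal.span {(q : 𝓞 L)} = P₂ ^ 3 ∧
            P₁.ramificationIdx (𝓞 F) = 3 ∧
            (3 : 𝓞 F) ∉ P₁.under (𝓞 F) ∧
            ¬ 9 ∣ Nat.card ((𝓞 F) ⧸ P₁.under (𝓞 F)) - 1 := by
  have hpq : p ≠ q := by
    rintro rfl
    omega
  have hp3 : p % 3 = 2 := by omega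
  have hq3 : q % 3 = 2 := by omega
  -- degrees
  have hKL : Module.finrank K L = 2 := by
    rw [IsCyclotomicExtension.finrank L (irreducible_cyclotomic_three_of_finrank_eq_three hK),
      Nat.totient_prime Nat.prime_three]
  have hL6 : Module.finrank ℚ L = 6 := by
    rw [← Module.finrank_mul_finrank ℚ K L, hK, hKL]
  -- `ζ₃ ∈ L`, `θ = α ∈ L`
  obtain ⟨ζ, hζ⟩ : ∃ ζ : L, IsPrimitiveRoot ζ 3 := ⟨_, IsCyclotomicExtension.zeta_spec 3 K L⟩
  have hθ : ∃ θ : L, θ ^ 3 = ((p * q : ℕ) : L) :=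
    ⟨algebraMap K L α, by rw [← map_pow, hα, map_natCast]⟩
  -- `L/ℚ` is Galois
  haveI : IsGalois ℚ L := isGalois_rat_of_isCyclotomicExtension_three hp hq hpq hK hα L
  -- `F = ℚ(ζ₃)`
  haveI hF : IsCyclotomicExtension {3} ℚ ℚ⟮ζ⟯ :=
    hζ.intermediateField_adjoin_isCyclotomicExtension ℚ
  have hF2 : Module.finrank ℚ ℚ⟮ζ⟯ = 2 := by
    rw [IsCyclotomicExtension.finrank (n := 3) ℚ⟮ζ⟯ (cyclotomic.irreducible_rat (by norm_num)),
      Nat.totient_prime Nat.prime_three]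
  have hFL : Module.finrank ℚ⟮ζ⟯ L = 3 := by
    have h := Module.finrank_mul_finrank ℚ ℚ⟮ζ⟯ L
    rw [hF2, hL6] at h
    omega
  refine ⟨hKL, hL6, ℚ⟮ζ⟯, inferInstance, hFL, ?_, IsCyclotomicExtension.Rat.three_pid ℚ⟮ζ⟯,
    (IsCyclotomicExtension.Rat.isTotallyComplex ℚ⟮ζ⟯ (n := 3) (by norm_num)).isComplex, hθ, ?_⟩
  · -- `Gal(L/F)` has prime order `3`, hence is cyclic
    haveI : Fact (Nat.Prime 3) := ⟨Nat.prime_three⟩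
    haveI : IsCyclic (L ≃ₐ[ℚ⟮ζ⟯] L) :=
      isCyclic_of_prime_card (p := 3) (by rw [IsGalois.card_aut_eq_finrank, hFL])
    exact IsCyclic.exists_generator
  -- units of `F`
  have hζF : IsPrimitiveRoot (⟨ζ, IntermediateField.mem_adjoin_simple_self ℚ ζ⟩ : ℚ⟮ζ⟯) 3 :=
    IsPrimitiveRoot.coe_submonoidClass_iff.mp hζ
  obtain ⟨η, hη, hunits⟩ := exists_units_eq_pow_or_neg_pow hζF
  refine ⟨η, ?_, ?_, hunits, ?_⟩
  · rw [hη]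
    exact hζF.pow_eq_one
  · rw [hη]
    exact hζF.ne_one (by norm_num)
  -- the primes above `p` and `q`
  obtain ⟨P₁, hP₁, hpP₁, hspan₁, he₁, h3, hcard⟩ :=
    exists_prime_pow_three_eq_span ℚ⟮ζ⟯ hL6 hp hq hpq hp3 hK hα
  have hα' : α ^ 3 = ((q * p : ℕ) : K) := by rwa [Nat.mul_comm]
  obtain ⟨P₂, hP₂, hqP₂, hspan₂, -, -, -⟩ :=
    exists_prime_pow_three_eq_span ℚ⟮ζ⟯ hL6 hq hp hpq.symm hq3 hK hα'
  refine ⟨P₁, P₂, hP₁, hP₂, ?_, hspan₁, hspan₂, he₁, h3, ?_⟩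
  · -- `P₁ ≠ P₂` since `(p, q) = 1`
    rintro rfl
    have hcop : IsCoprime (p : 𝓞 L) (q : 𝓞 L) := by
      have h' : IsCoprime (p : ℤ) (q : ℤ) :=
        Nat.isCoprime_iff_coprime.mpr ((Nat.coprime_primes hp hq).mpr hpq)
      simpa using h'.map (Int.castRingHom (𝓞 L))
    obtain ⟨a, b, hab⟩ := hcop
    exact hP₁.ne_top ((Ideal.eq_top_iff_one _).mpr
      (hab ▸ P₁.add_mem (P₁.mul_mem_left a hpP₁) (P₁.mul_mem_left b hqP₂)))
  · -- `#(𝓞F/𝔭) - 1 = p² - 1 ≡ 3 (mod 9)`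
    rw [hcard]
    have h1 : p ^ 2 % 9 = 4 := by
      rw [Nat.pow_mod, hp9]
    omega

/-- **Field set-up for the (2,5)-direction of Honda's criterion.**  For primes `p ≡ 2`,
`q ≡ 5 (mod 9)` and a cubic number field `K ∋ ∛(pq)`: the field `L = K(ζ₃)` (`[L:K] = 2`,
`[L:ℚ] = 6`), its subfield `F = ℚ(ζ₃)` with `L/F` cyclic cubic, `𝓞_F` a PID with units
`±ζ₃^i`, `F` totally complex, `θ = ∛(pq) ∈ L`, and the totally ramified primes `P₁ ∋ p`,
`P₂ ∋ q` of `L` (`p𝓞_L = P₁³`, `q𝓞_L = P₂³`, `e(P₁ | P₁ ∩ 𝓞_F) = 3`, `3 ∉ P₁ ∩ 𝓞_F`,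
`9 ∤ #(𝓞_F/P₁ ∩ 𝓞_F) − 1 = p² − 1`). [folklore] -/
theorem stub_fieldSetup :
    ∀ p q : ℕ, p.Prime → q.Prime → p % 9 = 2 → q % 9 = 5 →
    ∀ (K : Type) [Field K] [NumberField K], Module.finrank ℚ K = 3 →
      (∃ α : K, α ^ 3 = ((p * q : ℕ) : K)) →
      ∃ (L : Type) (_ : Field L) (_ : NumberField L) (_ : Algebra K L),
        Module.finrank K L = 2 ∧ Module.finrank ℚ L = 6 ∧
        ∃ F : IntermediateField ℚ L,
          IsGalois F L ∧ Module.finrank F L = 3 ∧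
          (∃ σ : L ≃ₐ[F] L, ∀ τ : L ≃ₐ[F] L, τ ∈ Subgroup.zpowers σ) ∧
          IsPrincipalIdealRing (𝓞 F) ∧
          (∀ v : NumberField.InfinitePlace F, v.IsComplex) ∧
          (∃ θ : L, θ ^ 3 = ((p * q : ℕ) : L)) ∧
          ∃ ζ : (𝓞 F)ˣ, ((ζ : 𝓞 F) : F) ^ 3 = 1 ∧ ((ζ : 𝓞 F) : F) ≠ 1 ∧
            (∀ w : (𝓞 F)ˣ, ∃ i : ℕ, w = ζ ^ i ∨ w = -ζ ^ i) ∧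
            ∃ P₁ P₂ : Ideal (𝓞 L), P₁.IsMaximal ∧ P₂.IsMaximal ∧ P₁ ≠ P₂ ∧
              Ideal.span {(p : 𝓞 L)} = P₁ ^ 3 ∧
              Ideal.span {(q : 𝓞 L)} = P₂ ^ 3 ∧
              P₁.ramificationIdx (𝓞 F) = 3 ∧
              (3 : 𝓞 F) ∉ P₁.under (𝓞 F) ∧
              ¬ 9 ∣ Nat.card ((𝓞 F) ⧸ P₁.under (𝓞 F)) - 1 := by
  intro p q hp hq hp9 hq9 K _ _ hK hα
  obtain ⟨α, hα⟩ := hα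
  exact ⟨CyclotomicField 3 K, inferInstance, inferInstance, inferInstance,
    fieldSetup_of_isCyclotomicExtension hp hq hp9 hq9 K hK hα (CyclotomicField 3 K)⟩

end Summit.QuantumAdvantage.QuantumAdvantage.Theorems.LinnikCubicClassGroups

end
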